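import Summits.Ventures.HodgeRepro.Night4ReducedDimQuadC12
import Summits.Ventures.HodgeRepro.Night4ReducedDimQuadC6xC2
import Summits.Ventures.HodgeRepro.Night4ReducedDimQuadC6xC2_01
import Summits.Ventures.HodgeRepro.Night4ReducedDimQuadC6xC2_31
import Summits.Ventures.HodgeRepro.Night4ReducedDimQuadD6
import Summits.Ventures.HodgeRepro.Night4ReducedDimQuadDic3
import Summits.Ventures.HodgeRepro.Night4ReducedDimTwelveRoute
import Summits.Ventures.HodgeRepro.Night4ReducedDimQuadWitnesses

/-!
# Beyond the census faces in degree 12, in general: the smallest objects of degree 12 on the kernel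

Blind re-derivation cell `pub-hodge-repro`, seat `night-4` (ROUTE HARDENING for the Monday FINAL, gen 6).  Target tree
path `lean/Summits/Ventures/HodgeRepro/Night4ReducedDimQuadRoute.lean`.

ROUTE.md v2.89 §3.5 (i) names «the ninefolds S₃ × A₆ (C6 × C2, D6) and S₃ × S₃′ × S₃″ (D6)» as the smallest open objects
of degree 12 — the smallest CENSUS faces (`Night4ReducedDimTwelveRoute.ninefolds_deg12`).  The exceptional `(2,2)`-classes
of the route are ALL the conjugate-free `SumTwo` quadruples (§3.1 / §3.6), and in degree 12 the non-census patterns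
`(3,2,1)`, `(2,2,2)` occur.  The six complete tables (`Night4ReducedDimQuadC12` / `…C6xC2` / `…C6xC2_01` / `…C6xC2_31` /
`…D6` / `…Dic3`) give, transported along the classification isomorphisms (`SumTwo.map`, `ConjFree.map`,
`degSixShape_mapSet_iff`):

* **`night4Quad_of_order12`**: on every classified `(G, c)` of order 12, every conjugate-free `SumTwo` quadruple of CM
  types has `dim B_red ∈ {4, 7, 8, 9, 10, 12, 13, 14, 15, 16, 18, 19, 20, 21, 24}` (`night4QuadVals12`), and the degree-6
  shape below 9; `four_le_…`, `…_le` (≤ 24), `…_lt_nine_iff` (below the census minimum exactly the values 4, 7, 8; never 5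
  or 6), `degSixShape_of_lt_nine_of_order12`; the same modulo the named classification `Night4Classify12` for every `(G, c)`
  with `|G| = 12` (`…_of_card_twelve`);
* **`smallest_deg12_beyond_census`** — the refinement of §3.5 (i) for the record: beyond the census the smallest objects
  of degree 12 are FOURFOLDS `E × S₃` on `C6 × C2` and `D6` (`dim B_red = 4` attained, `4 ≤` everywhere — in the route's
  closed regime, §3.0 «dim A ≤ 5»), the smallest OPEN ones the sevenfolds `E × A₆` of `C6 × C2` and the eightfolds
  `S₂ × A₆` of `C12` and `Dic3` (`8 ≤ dim B_red` on `C12` and `Dic3`, `8` attained); every object below the census minimum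
  has the degree-6 shape (pattern `(2,2,2)`, three translates of one type and one lift from a subfield of degree ≤ 4).

Nothing here says anything about the status of the Hodge conjecture for CM abelian varieties, which is NOT proved.
-/

set_option autoImplicit false

open Finset
open scoped Pointwise

namespace HodgeRepro

/-! ## Transport of quadruples along a group isomorphism -/

section Transport

variable {G G' : Type} [Group G] [Group G'] [Fintype G] [Fintype G'] [DecidableEq G] [DecidableEq G']

omit [Fintype G] [Fintype G'] in
/-- Transport keeps `SumTwo`. -/
theorem SumTwo.map (e : G ≃* G') {T : Fin 4 → Finset G} (hT : SumTwo T) : SumTwo (fun i => mapSet e (T i)) := by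
  intro x
  have h : (univ.filter fun i => x ∈ mapSet e (T i)) = univ.filter fun i => e.symm x ∈ T i :=
    Finset.filter_congr fun i _ => mem_mapSet e (T i) x
  rw [h]
  exact hT _

omit [Fintype G] [Fintype G'] in
/-- Transport keeps conjugate-freeness. -/
theorem ConjFree.map (e : G ≃* G') {c : G} {T : Fin 4 → Finset G} (h : ConjFree c T) :
    ConjFree (e c) (fun i => mapSet e (T i)) := by
  intro i j hij heq
  rw [← mapSet_smul] at heq
  exact h i j hij (mapSet_injective e heq)

omit [Fintype G] [Fintype G'] [DecidableEq G] [DecidableEq G'] in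
/-- Two transports are in the same isogeny class iff the types are. -/
theorem sameClass_mapSet_iff (e : G ≃* G') (S T : Finset G) :
    SameClass (mapSet e S) (mapSet e T) ↔ SameClass S T := by
  constructor
  · rintro ⟨k, hk⟩
    refine ⟨e.symm k, mapSet_injective e ?_⟩
    rw [mapSet_rmul, MulEquiv.apply_symm_apply]
    exact hk
  · rintro ⟨k, rfl⟩
    exact ⟨e k, (mapSet_rmul e S k).symm⟩

/-- The degree-6 shape is transported. -/
theorem degSixShape_mapSet_iff (e : G ≃* G') (T : Fin 4 → Finset G) :
    DegSixShape (fun i => mapSet e (T i)) ↔ DegSixShape T := by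
  unfold DegSixShape
  simp only [← mapSet_inter, card_mapSet, simpleDim_mapSet, sameClass_mapSet_iff]

/-- The table statement of a `(G', c')` transported back to `(G, c)` along `e : G ≃* G'`. -/
theorem night4Quad_transport (e : G ≃* G') {c : G} (T : Fin 4 → Finset G) (hT : ∀ i, IsCMType c (T i))
    (hsum : SumTwo T) (hconj : ConjFree c T) (vals : List ℕ)
    (H : ∀ T' : Fin 4 → Finset G', (∀ i, IsCMType (e c) (T' i)) → SumTwo T' → ConjFree (e c) T' →
      redDim T' ∈ vals ∧ (redDim T' < 9 → DegSixShape T')) :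
    redDim T ∈ vals ∧ (redDim T < 9 → DegSixShape T) := by
  have h := H (fun i => mapSet e (T i)) (fun i => (hT i).map e) (hsum.map e) (hconj.map e)
  rwa [redDim_mapSet, degSixShape_mapSet_iff] at h

end Transport

/-! ## Degree 12 in general, modulo the classification -/

section General

variable {G : Type} [Group G] [Fintype G] [DecidableEq G]

/-- The value set of `dim B_red` beyond the census in degree 12: the union of the six tables. -/
def night4QuadVals12 : List ℕ := [4, 7, 8, 9, 10, 12, 13, 14, 15, 16, 18, 19, 20, 21, 24]

/-- **Every conjugate-free `SumTwo` quadruple of CM types of every classified `(G, c)` of order 12 has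
`dim B_red ∈ {4, 7, 8, 9, 10, 12, 13, 14, 15, 16, 18, 19, 20, 21, 24}`, and the degree-6 shape below 9**: transport to the
named pair and the six complete tables. -/
theorem night4Quad_of_order12 {c : G} (hcl : Order12Classified c) (T : Fin 4 → Finset G)
    (hT : ∀ i, IsCMType c (T i)) (hsum : SumTwo T) (hconj : ConjFree c T) :
    redDim T ∈ night4QuadVals12 ∧ (redDim T < 9 → DegSixShape T) := by
  rcases hcl with ⟨e, hec⟩ | ⟨e, hec | hec | hec⟩ | ⟨e, hec⟩ | ⟨e, hec⟩
  · have h := night4Quad_transport e T hT hsum hconj night4QuadVals_C12 fun T' hT' hs hc' => by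
      rw [hec] at hT' hc'
      exact night4Quad_C12 T' hT' hs hc'
    refine ⟨?_, h.2⟩
    have h1 := h.1
    simp only [night4QuadVals_C12, night4QuadVals12, List.mem_cons, List.not_mem_nil, or_false] at h1 ⊢
    omega
  · have h := night4Quad_transport e T hT hsum hconj night4QuadVals_C6xC2 fun T' hT' hs hc' => by
      rw [hec] at hT' hc'
      exact night4Quad_C6xC2 T' hT' hs hc'
    refine ⟨?_, h.2⟩
    have h1 := h.1
    simp only [night4QuadVals_C6xC2, night4QuadVals12, List.mem_cons, List.not_mem_nil, or_false] at h1 ⊢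
    omega
  · have h := night4Quad_transport e T hT hsum hconj night4QuadVals_C6xC2_01 fun T' hT' hs hc' => by
      rw [hec] at hT' hc'
      exact night4Quad_C6xC2_01 T' hT' hs hc'
    refine ⟨?_, h.2⟩
    have h1 := h.1
    simp only [night4QuadVals_C6xC2_01, night4QuadVals12, List.mem_cons, List.not_mem_nil, or_false] at h1 ⊢
    omega
  · have h := night4Quad_transport e T hT hsum hconj night4QuadVals_C6xC2_31 fun T' hT' hs hc' => by
      rw [hec] at hT' hc'
      exact night4Quad_C6xC2_31 T' hT' hs hc'
    refine ⟨?_, h.2⟩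
    have h1 := h.1
    simp only [night4QuadVals_C6xC2_31, night4QuadVals12, List.mem_cons, List.not_mem_nil, or_false] at h1 ⊢
    omega
  · have h := night4Quad_transport e T hT hsum hconj night4QuadVals_D6 fun T' hT' hs hc' => by
      rw [hec] at hT' hc'
      exact night4Quad_D6 T' hT' hs hc'
    refine ⟨?_, h.2⟩
    have h1 := h.1
    simp only [night4QuadVals_D6, night4QuadVals12, List.mem_cons, List.not_mem_nil, or_false] at h1 ⊢
    omega
  · have h := night4Quad_transport e T hT hsum hconj night4QuadVals_Dic3 fun T' hT' hs hc' => by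
      rw [hec] at hT' hc'
      exact night4Quad_Dic3 T' hT' hs hc'
    refine ⟨?_, h.2⟩
    have h1 := h.1
    simp only [night4QuadVals_Dic3, night4QuadVals12, List.mem_cons, List.not_mem_nil, or_false] at h1 ⊢
    omega

/-- The complete value set of degree 12 beyond the census, on every classified `(G, c)`. -/
theorem redDim_sumTwo_of_order12 {c : G} (hcl : Order12Classified c) (T : Fin 4 → Finset G)
    (hT : ∀ i, IsCMType c (T i)) (hsum : SumTwo T) (hconj : ConjFree c T) : redDim T ∈ night4QuadVals12 :=
  (night4Quad_of_order12 hcl T hT hsum hconj).1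

/-- `4 ≤ dim B_red` on every conjugate-free `SumTwo` quadruple of every classified `(G, c)` of order 12. -/
theorem four_le_redDim_sumTwo_of_order12 {c : G} (hcl : Order12Classified c) (T : Fin 4 → Finset G)
    (hT : ∀ i, IsCMType c (T i)) (hsum : SumTwo T) (hconj : ConjFree c T) : 4 ≤ redDim T := by
  have h := redDim_sumTwo_of_order12 hcl T hT hsum hconj
  simp only [night4QuadVals12, List.mem_cons, List.not_mem_nil, or_false] at h
  omega

/-- `dim B_red ≤ 24` on every conjugate-free `SumTwo` quadruple of every classified `(G, c)` of order 12. -/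
theorem redDim_sumTwo_of_order12_le {c : G} (hcl : Order12Classified c) (T : Fin 4 → Finset G)
    (hT : ∀ i, IsCMType c (T i)) (hsum : SumTwo T) (hconj : ConjFree c T) : redDim T ≤ 24 := by
  have h := redDim_sumTwo_of_order12 hcl T hT hsum hconj
  simp only [night4QuadVals12, List.mem_cons, List.not_mem_nil, or_false] at h
  omega

/-- **Below the census minimum of degree 12 exactly the values 4, 7, 8 occur** (never 5 or 6). -/
theorem redDim_sumTwo_of_order12_lt_nine_iff {c : G} (hcl : Order12Classified c) (T : Fin 4 → Finset G)
    (hT : ∀ i, IsCMType c (T i)) (hsum : SumTwo T) (hconj : ConjFree c T) :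
    redDim T < 9 ↔ redDim T = 4 ∨ redDim T = 7 ∨ redDim T = 8 := by
  have h := redDim_sumTwo_of_order12 hcl T hT hsum hconj
  simp only [night4QuadVals12, List.mem_cons, List.not_mem_nil, or_false] at h
  omega

/-- **Below the census minimum, the degree-6 shape** on every classified `(G, c)` of order 12: pattern `(2,2,2)`, three
corners right translates of one type, the fourth lifted from a subfield of degree ≤ 4. -/
theorem degSixShape_of_lt_nine_of_order12 {c : G} (hcl : Order12Classified c) (T : Fin 4 → Finset G)
    (hT : ∀ i, IsCMType c (T i)) (hsum : SumTwo T) (hconj : ConjFree c T) (h : redDim T < 9) : DegSixShape T :=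
  (night4Quad_of_order12 hcl T hT hsum hconj).2 h

/-- The value set for EVERY Galois CM field of degree 12, modulo the named classification `Night4Classify12`. -/
theorem redDim_sumTwo_of_card_twelve (hcl : Night4Classify12) (hcard : Fintype.card G = 12) {c : G}
    (hc : IsComplexConj c) (T : Fin 4 → Finset G) (hT : ∀ i, IsCMType c (T i)) (hsum : SumTwo T)
    (hconj : ConjFree c T) : redDim T ∈ night4QuadVals12 :=
  redDim_sumTwo_of_order12 (Order12Classified_of_classify12 hcl hcard hc) T hT hsum hconj

/-- `4 ≤ dim B_red` for EVERY Galois CM field of degree 12, modulo `Night4Classify12`. -/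
theorem four_le_redDim_sumTwo_of_card_twelve (hcl : Night4Classify12) (hcard : Fintype.card G = 12) {c : G}
    (hc : IsComplexConj c) (T : Fin 4 → Finset G) (hT : ∀ i, IsCMType c (T i)) (hsum : SumTwo T)
    (hconj : ConjFree c T) : 4 ≤ redDim T :=
  four_le_redDim_sumTwo_of_order12 (Order12Classified_of_classify12 hcl hcard hc) T hT hsum hconj

/-- The degree-6 shape below 9 for EVERY Galois CM field of degree 12, modulo `Night4Classify12`. -/
theorem degSixShape_of_lt_nine_of_card_twelve (hcl : Night4Classify12) (hcard : Fintype.card G = 12) {c : G}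
    (hc : IsComplexConj c) (T : Fin 4 → Finset G) (hT : ∀ i, IsCMType c (T i)) (hsum : SumTwo T)
    (hconj : ConjFree c T) (h : redDim T < 9) : DegSixShape T :=
  degSixShape_of_lt_nine_of_order12 (Order12Classified_of_classify12 hcl hcard hc) T hT hsum hconj h

end General

/-! ## The smallest objects of degree 12 beyond the census — ROUTE.md §3.5 (i) refined -/

/-- **The smallest objects of degree 12 beyond the census, exactly** (the refinement of ROUTE.md §3.5 (i) for the
record): on `C12` and `Dic3` every conjugate-free `SumTwo` quadruple has `8 ≤ dim B_red`, with `8` attained (the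
eightfolds `S₂ × A₆`); on `C6 × C2` and `D6` `4 ≤ dim B_red`, with `4` attained (the fourfolds `E × S₃`, in the route's
closed regime) and, on `C6 × C2`, `7` attained (the sevenfolds `E × A₆`); nothing of degree 12 has `dim B_red ∈ {5, 6}`, and
everything below 9 has the degree-6 shape (`degSixShape_of_lt_nine_of_order12`). -/
theorem smallest_deg12_beyond_census :
    (∀ T : Fin 4 → Finset C12, (∀ i, IsCMType cc_C12 (T i)) → SumTwo T → ConjFree cc_C12 T → 8 ≤ redDim T) ∧
    (∃ T : Fin 4 → Finset C12, (∀ i, IsCMType cc_C12 (T i)) ∧ SumTwo T ∧ ConjFree cc_C12 T ∧ redDim T = 8) ∧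
    (∀ T : Fin 4 → Finset Dic3, (∀ i, IsCMType cc_Dic3 (T i)) → SumTwo T → ConjFree cc_Dic3 T → 8 ≤ redDim T) ∧
    (∃ T : Fin 4 → Finset Dic3, (∀ i, IsCMType cc_Dic3 (T i)) ∧ SumTwo T ∧ ConjFree cc_Dic3 T ∧ redDim T = 8) ∧
    (∀ T : Fin 4 → Finset C6xC2, (∀ i, IsCMType cc_C6xC2 (T i)) → SumTwo T → ConjFree cc_C6xC2 T → 4 ≤ redDim T) ∧
    (∃ T : Fin 4 → Finset C6xC2, (∀ i, IsCMType cc_C6xC2 (T i)) ∧ SumTwo T ∧ ConjFree cc_C6xC2 T ∧ redDim T = 4) ∧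
    (∃ T : Fin 4 → Finset C6xC2, (∀ i, IsCMType cc_C6xC2 (T i)) ∧ SumTwo T ∧ ConjFree cc_C6xC2 T ∧ redDim T = 7) ∧
    (∀ T : Fin 4 → Finset D6, (∀ i, IsCMType cc_D6 (T i)) → SumTwo T → ConjFree cc_D6 T → 4 ≤ redDim T) ∧
    (∃ T : Fin 4 → Finset D6, (∀ i, IsCMType cc_D6 (T i)) ∧ SumTwo T ∧ ConjFree cc_D6 T ∧ redDim T = 4) :=
  ⟨eight_le_redDim_sumTwo_C12,
    ⟨night4Quad_C12_eight, night4Quad_C12_eight_isCMType, night4Quad_C12_eight_sumTwo, night4Quad_C12_eight_conjFree,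
      night4Quad_C12_eight_redDim⟩,
    eight_le_redDim_sumTwo_Dic3,
    ⟨night4Quad_Dic3_eight, night4Quad_Dic3_eight_isCMType, night4Quad_Dic3_eight_sumTwo, night4Quad_Dic3_eight_conjFree,
      night4Quad_Dic3_eight_redDim⟩,
    four_le_redDim_sumTwo_C6xC2,
    ⟨night4Quad_C6xC2_four, night4Quad_C6xC2_four_isCMType, night4Quad_C6xC2_four_sumTwo, night4Quad_C6xC2_four_conjFree,
      night4Quad_C6xC2_four_redDim⟩,
    ⟨night4Quad_C6xC2_seven, night4Quad_C6xC2_seven_isCMType, night4Quad_C6xC2_seven_sumTwo,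
      night4Quad_C6xC2_seven_conjFree, night4Quad_C6xC2_seven_redDim⟩,
    four_le_redDim_sumTwo_D6,
    ⟨night4Quad_D6_four, night4Quad_D6_four_isCMType, night4Quad_D6_four_sumTwo, night4Quad_D6_four_conjFree,
      night4Quad_D6_four_redDim⟩⟩

/-- **The value 7 is the smallest OPEN reduced dimension of degree 12 beyond the census on `C6 × C2`**: nothing of
degree 12 has `dim B_red ∈ {5, 6}` (on any classified `(G, c)`), `4` is in the closed regime (ROUTE.md §3.0: dim ≤ 5), and
`7` is attained on `C6 × C2` (the sevenfold `E × A₆`). -/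
theorem no_five_six_deg12 {G : Type} [Group G] [Fintype G] [DecidableEq G] {c : G} (hcl : Order12Classified c)
    (T : Fin 4 → Finset G) (hT : ∀ i, IsCMType c (T i)) (hsum : SumTwo T) (hconj : ConjFree c T) :
    redDim T ≠ 5 ∧ redDim T ≠ 6 := by
  have h := redDim_sumTwo_of_order12 hcl T hT hsum hconj
  simp only [night4QuadVals12, List.mem_cons, List.not_mem_nil, or_false] at h
  omega

end HodgeRepro
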